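import Literature.NumberTheory.GaloisRepresentations.AbsGaloisStronglyComplete
import Literature.AnabelianGeometry.AbsoluteAnabelian.MonoidKummerMapsTLGLiftOfFiniteIndexOpen
import Summits.ABC.IUTFork.MLFGaloisTFG
import HarnessLib

/-!
# `Gal(k̄/k)` is strongly complete, UNCONDITIONALLY (`k/ℚ_p` finite) — FACT F-1977 at `G_k`
# DISCHARGED; F-0412 / F-0409 / F-0413 / (BA_abs) without Nikolov–Segal

Cell `abc-iut` (run/shared/lean/pub/abc-iut/), rung LADDER-ABC:A2.C, GAP row G-L3d2g2-1.  The
Literature theorem `isOpen_of_finiteIndex_absoluteGaloisGroup` (abc-iut-w6-d103, route: operator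
Serre lemma `Literature/GroupTheory/ProP/OperatorFrattiniOpen.lean` + topological normal finite
generation of the wild inertia group `NormalGeneratorsProfinite.lean` + abc-iut-w5-d200's tame
reduction `MLFGaloisStronglyCompleteReduction.lean`) proves that every finite-index subgroup of
`Γ_k = Gal(k̄/k)` is open, for `k` a non-archimedean local field of characteristic `0` whose `Γ_k` is
topologically finitely generated.  The last hypothesis is PROVED in the tree but Summits-side
(`isTopologicallyFinitelyGenerated_absoluteGaloisGroup_local`, via Tate's Euler–Poincaré
characteristic `localEulerPoincareCharacteristic_holds`), so the unconditional statements are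
assembled HERE, exactly as `MonoidKummerMapsLiftsOfFiniteIndexOpen.lean` did MODULO F-1977:

* `forall_finiteIndex_isOpen_absoluteGaloisGroup` — **every finite-index subgroup of `Gal(k̄/k)` is
  open**, unconditionally: the instance at `G_k` of the Nikolov–Segal theorem quoted in [IUTchI]
  Rmk. 2.5.3 (vi) (FACT F-1977 `Rmk253.FiniteIndexOpenOfTopFG` AT `G_k`; the general named fact is not
  claimed);
* `exists_galoisContinuousMulEquiv_of_mulEquiv` — abstract isomorphisms of absolute Galois groups of
  MLFs are topological;
* `biAnabelianUnits_abstract` — (BA_abs) of abc-iut-L6-d1's reduction, unconditional;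
* `tlgLifting`, `tcgLifting` — the [AbsTopIII] Prop. 3.3 (ii) lifting sentences for ALL MLF-Galois
  `TLG` / `TCG`-pairs, unconditional;
* `unitPairIsoFibres_holds` — **FACT F-0412 `UnitPairIsoFibres` PROVED** (cone node
  AbsTopIII:Prop3.3(ii)); `galoisIsoLiftsToTMPairIso_holds H` (F-0409, every `H`),
  `unitPairIsoFibresOfType_holds H` (F-0413, every `H`).

HONEST FRAMING: OUR kernel proofs of classical statements ([AbsTopIII] 2015 Prop. 3.2 (iv) / 3.3 (ii)
and the `p`-adic case of Nikolov–Segal 2003/2007); nothing here bears on [IUTchIII] Cor. 3.12 or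
asserts that abc is proved or refuted.

## References

* N. Nikolov, D. Segal, *Finite index subgroups in profinite groups*, C. R. Acad. Sci. 337 (2003),
  Thm 1.1. [NikolovSegal2003]
* S. Mochizuki, *Inter-universal Teichmüller Theory I*, Rmk. 2.5.3 (vi). [Mochizuki2012]
* S. Mochizuki, *Topics in Absolute Anabelian Geometry III* (2015), Prop. 3.2 (iv), 3.3 (ii).
  [MochizukiAbsTopIII2015]
-/

noncomputable section

open scoped nonZeroDivisors

namespace Summit.ABC.IUTFork

open Field Literature.AnabelianGeometry.AbsoluteAnabelian Literature.NumberTheory.GaloisRepresentations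
open Literature.IUT.HodgeTheaters.Rmk253 (continuous_of_forall_finiteIndex_isOpen)

universe u

/-- **Every finite-index subgroup of `Gal(k̄/k)` is open, unconditionally**, for every
non-archimedean local field `k` of characteristic `0`: `isOpen_of_finiteIndex_absoluteGaloisGroup`
with the topological finite generation of `Γ_k` supplied by
`isTopologicallyFinitelyGenerated_absoluteGaloisGroup_local`.  FACT F-1977 at `G_k`.
[cite: NikolovSegal2003, Thm 1.1] [cite: Mochizuki2012, IUTchI Rmk 2.5.3 (vi) (O3) p.56] -/
theorem forall_finiteIndex_isOpen_absoluteGaloisGroup (k : Type) [Field k] [ValuativeRel k]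
    [TopologicalSpace k] [IsNonarchimedeanLocalField k] [CharZero k]
    (U : Subgroup (absoluteGaloisGroup k)) (hU : U.FiniteIndex) :
    IsOpen (U : Set (absoluteGaloisGroup k)) := by
  haveI := hU
  exact isOpen_of_finiteIndex_absoluteGaloisGroup k
    (isTopologicallyFinitelyGenerated_absoluteGaloisGroup_local k) U

/-- **Every homomorphism from `Gal(k̄/k)` to a finite group is continuous**, unconditionally
(`k` a non-archimedean local field of characteristic `0`). [cite: NikolovSegal2003, Thm 1.1] -/
theorem isOpen_ker_absoluteGaloisGroup_of_finite (k : Type) [Field k] [ValuativeRel k]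
    [TopologicalSpace k] [IsNonarchimedeanLocalField k] [CharZero k]
    {H : Type*} [Group H] [Finite H] (f : absoluteGaloisGroup k →* H) :
    IsOpen ((f.ker : Subgroup (absoluteGaloisGroup k)) : Set (absoluteGaloisGroup k)) :=
  isOpen_ker_of_finite_absoluteGaloisGroup k (isTopologicallyFinitelyGenerated_absoluteGaloisGroup_local k) f

/-- "Every finite-index subgroup is open" is transported along isomorphisms of topological groups.
[cite: NikolovSegal2003, Thm 1.1] -/
theorem forall_finiteIndex_isOpen_of_continuousMulEquiv' {G H : Type*} [Group G] [TopologicalSpace G]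
    [Group H] [TopologicalSpace H] (e : G ≃ₜ* H)
    (hG : ∀ U : Subgroup G, U.FiniteIndex → IsOpen (U : Set G)) (V : Subgroup H)
    (hV : V.FiniteIndex) : IsOpen (V : Set H) := by
  have h1 : (V.comap e.toMulEquiv.toMonoidHom).FiniteIndex := by
    rw [Subgroup.finiteIndex_iff, Subgroup.index_comap_of_surjective _ e.toMulEquiv.surjective]
    exact Subgroup.finiteIndex_iff.mp hV
  have h2 : IsOpen ((V.comap e.toMulEquiv.toMonoidHom : Subgroup G) : Set G) := hG _ h1
  have h3 : (V : Set H) = e.symm ⁻¹' ((V.comap e.toMulEquiv.toMonoidHom : Subgroup G) : Set G) := by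
    ext x
    change x ∈ V ↔ e (e.symm x) ∈ V
    rw [ContinuousMulEquiv.apply_symm_apply]
  rw [h3]
  exact h2.preimage e.symm.continuous

/-- Finite-index subgroups of `Aut_k(K)` are open for every MLF closure datum `(k, K = k̄)`,
unconditionally. [cite: NikolovSegal2003, Thm 1.1] -/
theorem forall_finiteIndex_isOpen_gal (C : MLFClosure.{0}) (U : Subgroup (C.K ≃ₐ[C.k] C.K))
    (hU : U.FiniteIndex) : IsOpen (U : Set (C.K ≃ₐ[C.k] C.K)) :=
  forall_finiteIndex_isOpen_of_continuousMulEquiv'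
    (algEquivContinuousMulEquivAbsoluteGaloisGroup C.k C.K).symm
    (forall_finiteIndex_isOpen_absoluteGaloisGroup C.k) U hU

/-- **Abstract isomorphisms of absolute Galois groups of MLFs are topological**, unconditionally:
every isomorphism of GROUPS `Aut_{k₁}(k̄₁) ⥲ Aut_{k₂}(k̄₂)` is (the underlying map of) an isomorphism
of topological groups. [cite: Mochizuki2012, IUTchI Rmk 2.5.3 (vi) (O3) p.56]
[cite: NikolovSegal2003, Thm 1.1] -/
theorem exists_galoisContinuousMulEquiv_of_mulEquiv (C₁ C₂ : MLFClosure.{0})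
    (α : (C₁.K ≃ₐ[C₁.k] C₁.K) ≃* (C₂.K ≃ₐ[C₂.k] C₂.K)) :
    ∃ α' : (C₁.K ≃ₐ[C₁.k] C₁.K) ≃ₜ* (C₂.K ≃ₐ[C₂.k] C₂.K), ∀ σ, α' σ = α σ := by
  let e₁ := algEquivContinuousMulEquivAbsoluteGaloisGroup C₁.k C₁.K
  let e₂ := algEquivContinuousMulEquivAbsoluteGaloisGroup C₂.k C₂.K
  let α₀ : absoluteGaloisGroup C₁.k ≃* absoluteGaloisGroup C₂.k :=
    e₁.symm.toMulEquiv.trans (α.trans e₂.toMulEquiv)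
  let α₀' : absoluteGaloisGroup C₁.k ≃ₜ* absoluteGaloisGroup C₂.k :=
    { α₀ with
      continuous_toFun := continuous_of_forall_finiteIndex_isOpen
        (forall_finiteIndex_isOpen_absoluteGaloisGroup C₁.k) α₀.toMonoidHom
      continuous_invFun := continuous_of_forall_finiteIndex_isOpen
        (forall_finiteIndex_isOpen_absoluteGaloisGroup C₂.k) α₀.symm.toMonoidHom }
  have hα₀' : ∀ g, α₀' g = α₀ g := fun _ => rfl
  refine ⟨e₁.trans (α₀'.trans e₂.symm), fun σ => ?_⟩
  show e₂.symm (α₀' (e₁ σ)) = α σ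
  rw [hα₀']
  show e₂.symm (e₂ (α (e₁.symm (e₁ σ)))) = α σ
  rw [ContinuousMulEquiv.symm_apply_apply, ContinuousMulEquiv.symm_apply_apply]

/-- **(BA_abs), unconditionally**: for MLF closure data `C₁, C₂` and every ABSTRACT isomorphism `α` of
the Galois groups there is an `α`-equivariant multiplicative bijection `β : k̄₁^× ⥲ k̄₂^×` — from (BA)
(`biAnabelianUnits_holds`, local class field theory) and the automatic continuity of `α`.
[cite: MochizukiAbsTopIII2015, Proposition 3.2 (iv) p.72] -/
theorem biAnabelianUnits_abstract (C₁ C₂ : MLFClosure.{0}) (α : (C₁.K ≃ₐ[C₁.k] C₁.K) ≃* (C₂.K ≃ₐ[C₂.k] C₂.K)) :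
    ∃ β : (C₁.K)⁰ ≃* (C₂.K)⁰, ∀ (σ : C₁.K ≃ₐ[C₁.k] C₁.K) (x y : (C₁.K)⁰), (y : C₁.K) = σ x →
      ((β y : (C₂.K)⁰) : C₂.K) = α σ ((β x : (C₂.K)⁰) : C₂.K) := by
  obtain ⟨α', hα'⟩ := exists_galoisContinuousMulEquiv_of_mulEquiv C₁ C₂ α
  obtain ⟨β, hβ⟩ := biAnabelianUnits_holds C₁ C₂ α'
  exact ⟨β, fun σ x y h => by rw [hβ σ x y h, hα']⟩

/-- **The `TLG` lifting sentence for ALL MLF-Galois `TLG`-pairs, unconditionally** ([AbsTopIII]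
Prop. 3.3 (ii) surjectivity): every admissible `Π ⥲ Π*` lifts to an isomorphism of pairs.
[cite: MochizukiAbsTopIII2015, Proposition 3.3 (ii) p.74] -/
theorem tlgLifting (P Q : GaloisMonoidPair.{0}) (hP : IsMLFGaloisMonoidPair .TLG P)
    (hQ : IsMLFGaloisMonoidPair .TLG Q) (f : P.Pi ≃ₜ* Q.Pi)
    (hf : P.actionKer.map f.toMulEquiv.toMonoidHom = Q.actionKer) :
    ∃ e : GaloisMonoidPair.Iso P Q, e.isoPi = f :=
  tlgLifting_of_biAnabelianUnits_abstract biAnabelianUnits_abstract P Q hP hQ f hf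

/-- **The `TCG` lifting sentence for ALL MLF-Galois `TCG`-pairs, unconditionally** ([AbsTopIII]
Prop. 3.3 (ii)). [cite: MochizukiAbsTopIII2015, Proposition 3.3 (ii) p.74] -/
theorem tcgLifting (P Q : GaloisMonoidPair.{0}) (hP : IsMLFGaloisMonoidPair .TCG P)
    (hQ : IsMLFGaloisMonoidPair .TCG Q) (f : P.Pi ≃ₜ* Q.Pi)
    (hf : P.actionKer.map f.toMulEquiv.toMonoidHom = Q.actionKer) :
    ∃ e : GaloisMonoidPair.Iso P Q, e.isoPi = f :=
  tcgLifting_of_biAnabelianUnits_abstract biAnabelianUnits_abstract P Q hP hQ f hf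

/-- **FACT F-0412 `UnitPairIsoFibres` PROVED, unconditionally** ([AbsTopIII] Prop. 3.3 (ii), the
pre-erratum named fact of abc-iut-L4-t2; both conjuncts, all MLF-Galois `TLG`/`TCG`-pairs).
[cite: MochizukiAbsTopIII2015, Proposition 3.3 (ii) p.74] -/
theorem unitPairIsoFibres_holds : Literature.AnabelianGeometry.AbsoluteAnabelian.UnitPairIsoFibres :=
  unitPairIsoFibres_of_biAnabelianUnits_abstract biAnabelianUnits_abstract

/-- **F-0409 `GaloisIsoLiftsToTMPairIso H` for EVERY `H`, unconditionally** ([AbsTopIII] Prop. 3.2 (iv),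
author's corrected form). [cite: MochizukiAbsTopIII2015, Proposition 3.2 (iv) p.72]
[cite: MochizukiAbsTopIIIComments2019, item (5)] -/
theorem galoisIsoLiftsToTMPairIso_holds (H : GaloisMonoidPair.{0} → Prop) :
    Literature.AnabelianGeometry.AbsoluteAnabelian.GaloisIsoLiftsToTMPairIso H :=
  galoisIsoLiftsToTMPairIso_of_biAnabelianUnits_abstract biAnabelianUnits_abstract H

/-- **F-0413 `UnitPairIsoFibresOfType H` for EVERY `H`, unconditionally** ([AbsTopIII] Prop. 3.3 (ii)
as corrected, both clauses). [cite: MochizukiAbsTopIII2015, Proposition 3.3 (ii) p.74]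
[cite: MochizukiAbsTopIIIComments2019, item (5)] -/
theorem unitPairIsoFibresOfType_holds (H : GaloisMonoidPair.{0} → Prop) :
    Literature.AnabelianGeometry.AbsoluteAnabelian.UnitPairIsoFibresOfType H :=
  unitPairIsoFibresOfType_of_biAnabelianUnits_abstract biAnabelianUnits_abstract H

/-- **Every homomorphism from `Gal(k̄/k)` to a profinite group is continuous**, unconditionally
(`k` a non-archimedean local field of characteristic `0`; `K` any compact totally disconnected
topological group): [IUTchI] Rmk. 2.5.3 (vi) (O3) "the conditions (c), (c^new) in fact hold
automatically" AT `G_k`, via `Rmk253.continuous_of_forall_finiteIndex_isOpen` and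
`forall_finiteIndex_isOpen_absoluteGaloisGroup`. [cite: Mochizuki2012, IUTchI Rmk 2.5.3 (vi) (O3) p.56]
[cite: NikolovSegal2003, Thm 1.1] -/
theorem continuous_of_absoluteGaloisGroup_to_profinite (k : Type) [Field k] [ValuativeRel k]
    [TopologicalSpace k] [IsNonarchimedeanLocalField k] [CharZero k]
    {K : Type} [Group K] [TopologicalSpace K] [IsTopologicalGroup K] [CompactSpace K]
    [TotallyDisconnectedSpace K] (f : absoluteGaloisGroup k →* K) : Continuous f :=
  continuous_of_forall_finiteIndex_isOpen (forall_finiteIndex_isOpen_absoluteGaloisGroup k) f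

/-- **Abstract isomorphisms `Gal(k̄₁/k₁) ≅ Gal(k̄₂/k₂)` are homeomorphisms**, unconditionally (both
`p`-adic fields of characteristic `0`): the `absoluteGaloisGroup` form of
`exists_galoisContinuousMulEquiv_of_mulEquiv`. [cite: Mochizuki2012, IUTchI Rmk 2.5.3 (vi) (O3) p.56]
[cite: NikolovSegal2003, Thm 1.1] -/
theorem exists_continuousMulEquiv_absoluteGaloisGroup_of_mulEquiv (k₁ k₂ : Type) [Field k₁]
    [ValuativeRel k₁] [TopologicalSpace k₁] [IsNonarchimedeanLocalField k₁] [CharZero k₁] [Field k₂]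
    [ValuativeRel k₂] [TopologicalSpace k₂] [IsNonarchimedeanLocalField k₂] [CharZero k₂]
    (α : absoluteGaloisGroup k₁ ≃* absoluteGaloisGroup k₂) :
    ∃ α' : absoluteGaloisGroup k₁ ≃ₜ* absoluteGaloisGroup k₂, ∀ σ, α' σ = α σ :=
  ⟨{ α with
      continuous_toFun := continuous_of_forall_finiteIndex_isOpen
        (forall_finiteIndex_isOpen_absoluteGaloisGroup k₁) α.toMonoidHom
      continuous_invFun := continuous_of_forall_finiteIndex_isOpen
        (forall_finiteIndex_isOpen_absoluteGaloisGroup k₂) α.symm.toMonoidHom },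
    fun _ => rfl⟩

end Summit.ABC.IUTFork

end
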